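import Literature.Algebra.EuclideanLattices.KhotInputCodeFP
import HarnessLib

/-!
# Khot 2005, §5.2.2 (machine level): the random row vector `r` read off the coins is computable in polynomial time

Topic `Algebra/EuclideanLattices`, namespace `Literature.Algebra.EuclideanLattices.Khot`. Companion of
`KhotInputCodeFP.lean` (coin blocks `blockFP`/`blockValFP`) and `KhotShiftFP.lean` (the sampled column
tuple `g` and the shift `s'`) towards the machine hypothesis of
`gapSVP_const_isNPHardRandomized_of_prop6_of_FP_explicit` / `Khot2005_SAT_randReducible_gapSVP_of_prop6_of_FP_explicit`.
The second component of `coinDecode u σ K k c` (`KhotReduction.lean`) is the random row vector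
`r = rOf u σ K k c ∈ (ℤ/q₂)^{rows}` of the last row of Khot's base basis (`finBasis … (liftRow r) D q`,
§5.2.2: "each of which is chosen randomly from the range `[0, q-1]`"): entry `ρ` is the little-endian
value of the coin block `idxR ρ` of width `lq = log₂ q₂` after the first `Lg = 31K·M` coins. As the
base basis carries the INTEGER lift `liftRow r` (entries in `[0, q₂)`), and a block value is `< 2^{lq} = q₂`,
the lift is the block value itself:

* `rVals n w L c` — the `n` block values of width `w` after the first `L` coins, as integers;
  **`getD_rVals`**: item `idxR ρ` of `khotRVals u σ K k c := rVals rows lq Lg c` is `liftRow (rOf u σ K k c) ρ`;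
* `rValsFP` (`(((1ⁿ, 1ʷ), 1ᴸ), c) ↦ rVals n w L c`), and the unary inputs from `(1ᴷ, 1ᴹ)`: `LgFP`
  (`31K·M`).

All proved; no facts.

## References

* S. Khot, *Hardness of approximating the shortest vector problem in lattices*, J. ACM 52 (2005)
  789–808, §5.2.2, §7.3.
* S. Arora, B. Barak, *Computational Complexity: A Modern Approach*, CUP 2009, §1.3.
-/

namespace Literature.Algebra.EuclideanLattices.Khot

open Params
open Literature.Computability.Complexity Literature.Computability.Complexity.CodeFP
  Literature.Computability.MetaComplexity

/-! ### The list program and its correctness -/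

/-- The `n` coin-block values of width `w` after the first `L` coins, as integers. [cite: Khot2005, §5.2.2] -/
def rVals (n w L : ℕ) (c : List Bool) : List ℤ :=
  (List.range n).map fun i => (bitsToNat (block w (c.drop L) i) : ℤ)

/-- Length of `rVals`. [folklore] -/
theorem length_rVals (n w L : ℕ) (c : List Bool) : (rVals n w L c).length = n := by simp [rVals]

/-- Items of `rVals`. [folklore] -/
theorem getD_rVals_of_lt {n : ℕ} (w L : ℕ) (c : List Bool) {i : ℕ} (hi : i < n) :
    (rVals n w L c).getD i 0 = (bitsToNat (block w (c.drop L) i) : ℤ) := by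
  rw [rVals, List.getD_eq_getElem _ _ (by simpa using hi)]
  simp

/-- **Khot's random row vector as a program**: `rows` blocks of width `lq` after the first `Lg` coins.
[cite: Khot2005, §5.2.2] -/
def khotRVals (u σ K k : ℕ) (c : List Bool) : List ℤ :=
  rVals (rows u σ K k) (lq u σ K k) (Lg u σ K k) c

/-- The integer lift of a residue read off a block of width `lq` is the block value (`< 2^{lq} = q₂`).
[cite: Khot2005, §5.2.2] -/
theorem liftRow_rOf (u σ K k : ℕ) (c : List Bool) (ρ : RowsT u σ K k) :
    liftRow (rOf u σ K k c) ρ = (bitsToNat (block (lq u σ K k) (c.drop (Lg u σ K k)) (idxR u σ K k ρ)) : ℤ) := by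
  unfold liftRow rOf
  rw [ZMod.val_natCast, Nat.mod_eq_of_lt]
  unfold q₂
  exact bitsToNat_block_lt _ _ _

/-- **The program computes `liftRow r`**: item `idxR ρ` of `khotRVals u σ K k c` is the entry `ρ` of the
integer lift of the random row vector `rOf u σ K k c`. [cite: Khot2005, §5.2.2] -/
theorem getD_khotRVals (u σ K k : ℕ) (c : List Bool) (ρ : RowsT u σ K k) :
    (khotRVals u σ K k c).getD (idxR u σ K k ρ) 0 = liftRow (rOf u σ K k c) ρ := by
  rw [khotRVals, getD_rVals_of_lt _ _ _ (idxR u σ K k ρ).isLt, liftRow_rOf]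

/-- Length of `khotRVals`: `rows`. [folklore] -/
theorem length_khotRVals (u σ K k : ℕ) (c : List Bool) : (khotRVals u σ K k c).length = rows u σ K k :=
  length_rVals _ _ _ _

/-! ### Polynomial time -/

/-- **The block values on codes**: `(((1ⁿ, 1ʷ), 1ᴸ), c) ↦ rVals n w L c` — drop `L` coins, then a loop
over `[0, n)` of block values (item index converted to unary under the budget `n`). [cite: Khot2005, §5.2.2; AroraBarak2009, §1.3] -/
theorem rValsFP : CodeFP (pairE (pairE (pairE unE unE) unE) strE) (rawE intE) (fun p => rVals p.1.1.1 p.1.1.2 p.1.2 p.2) := by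
  -- context `((1ⁿ, 1ʷ), c')` with `c' = c.drop L`, item `i` (binary)
  have hval : CodeFP (pairE (pairE (pairE unE unE) strE) natE) intE
      (fun t => (bitsToNat (block t.1.1.2 t.1.2 (min t.2 t.1.1.1)) : ℤ)) :=
    intOfNat.comp (blockValFP.comp ((((fst _ _).fst'.snd'.pair (unOfNatMin.comp ((fst _ _).fst'.fst'.pair (snd _ _))))).pair
      (fst _ _).snd'))
  have hdrop : CodeFP (pairE (pairE (pairE unE unE) unE) strE) strE (fun p => p.2.drop p.1.2) :=
    strDrop.comp ((fst _ _).snd'.pair (snd _ _))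
  have hmap := (map hval).comp ((((fst _ _).fst'.pair hdrop)).pair (urange.comp (fst _ _).fst'.fst'))
  refine hmap.congr fun p => ?_
  simp only [rVals]
  refine List.map_congr_left fun i hi => ?_
  rw [List.mem_range] at hi
  rw [min_eq_left hi.le]

/-- `Lg = 31K·M` in unary from `(1ᴷ, 1ᴹ)`. [cite: Khot2005, §5.2.2; AroraBarak2009, §1.3] -/
theorem LgFP : CodeFP (pairE unE unE) unE (fun p => 31 * p.1 * p.2) :=
  ((ulength unitE).comp (unitsMul.comp ((unitsMul.comp ((const _ (List.replicate 31 ())).pair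
    (replicateUnit.comp (fst _ _)))).pair (replicateUnit.comp (snd _ _))))).congr fun p => by simp

/-- The program named (definitional unfolding, for `CodeFP.congr`). [folklore] -/
theorem khotRVals_eq (u σ K k : ℕ) (c : List Bool) :
    khotRVals u σ K k c = rVals (rows u σ K k) (lq u σ K k) (31 * K * MM u σ K k) c := rfl

end Literature.Algebra.EuclideanLattices.Khot
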